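import Literature.NumberTheory.NumberFields.RayClassFieldLocalTowerDisjoint
import HarnessLib

/-!
# THE LUBIN–TATE CHARACTER OF A LOCAL LIFT IS DETERMINED BY ITS RESTRICTIONS TO THE GLOBAL `v`-TOWER, and
# `χ_π(σ̃_{(a)}) = a` for the local lifts of the Artin symbols of a principal ideal `(a)`, `a ≡ 1 mod 𝔪`
# (de Shalit II.1.10 / II.4.12: `σ_{𝔞₁}`, `𝔞₁ = (α₁)`, acts on the `𝔭`-division tower through `κ(σ_(α)) = α`)

Setting of `RayClassFieldLocalTowerDisjoint.lean`: `K` totally complex, `𝔪 ≠ 0`, `v ∤ 𝔪`, `w_𝔪 = 1`, a uniformiser `π` of `K_v`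
with the absolute model `α = π^f` (`α ∈ 𝓞_K`, `α ≡ 1 mod 𝔪`, `(α) = 𝔭_v^f`), a finite base `E ⊆ K̄_v` with `f ∣ deg w` on the
Weil elements fixing `E`, and the INERT hypothesis «every `τ ∈ Γ_{K_v}` fixing `ι K(𝔪)` pointwise fixes `E`» (`E ⊆ Φ_𝔪 =
(K(𝔪))_𝔓`).  The elliptic-unit product rule of the (c)-capstone (`Summit…ColemanCoinvariantEllipticUnits…`) is indexed by ANY
local lifts `σ̃_𝔞 ∈ Γ_{K_v}` of the Artin symbols `(𝔞, K(𝔪v^{k+1})/K)`; its division hypothesis (A) asks for the VALUE of the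
Lubin–Tate character `χ_π(σ̃_{𝔞₁})`.  THIS file computes it:

* ★ `lubinTateChar_eq_of_forall_absRestrictNormalHom_eq` — **`χ_π(σ̃)` depends only on the restrictions
  `res σ̃|_{K(𝔪v^{k+1})}`, `k ≥ 0`**: two local elements with the same restrictions differ by an element fixing `ι K(𝔪v^{k+1})`
  for all `k`, hence (INERT) fixing `E`, hence (linear disjointness
  `mem_fixingSubgroup_ltField_of_forall_smul_absClosureEmbedding_eq`) fixing every `K_π^{k+1}` — and `χ_π = 1` exactly there
  (`lubinTateChar_eq_one_iff`);
* ★★ `coe_lubinTateChar_eq_of_forall_eq_artinHom` / `…_eq_artinSymbol_span_singleton` — **`χ_π(σ̃) = a` in `K_v`** for every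
  local lift `σ̃` of the Artin symbols of a principal ideal `(a)`, `a ≡ 1 mod 𝔪`, `v ∤ a` (the inertia element `w` with
  `Art(w) = a_v` has the same restrictions — `[⟨a_v⁻¹⟩_v, K]| = ((a), ·)`, `RayClassFieldAdicCharacterPrincipal` — and
  `χ_π(w) = Art(w)`, Lubin–Tate reciprocity);
* `coe_lubinTateChar_eq_of_forall_eq_artinSymbol_span_singleton₂` — the same read on the bottom row `K(𝔤v'v^{k+1})` of the
  two-variable tower of `RayClassFieldTwoVariableDecomposition` (index `i = 0`, base `E_c`): for de Shalit's `𝔞₁ = (α₁)`,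
  `α₁ ≡ 1 mod 𝔤v'`, **`χ_π(σ̃_{𝔞₁}) = α₁`**, so hypothesis (A) `χ_π(σ̃_{a₁}) = γ = 1 + π²w` of the capstone is met by any
  `α₁ ≡ 1 mod 𝔤v'` with `v(α₁ − 1) = 2`.

Theorems only; no `sorry`; no definitions.

## References
* [deShalit1987] E. de Shalit, *Iwasawa theory of elliptic curves with complex multiplication* (1987), I.1.8 (p. 11), II.1.7 (p. 41),
  II.1.10 Lemma (p. 39), II.4.12 (p. 66–68), II.4.17 (p. 78).
* [CasselsFrohlichANT1967] Cassels–Fröhlich (1967), Ch. VI §3.4 Thm. 3, §3.6 Prop. 6, §3.7 Thm. 3.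
* [NeukirchANT1999] J. Neukirch, *Algebraic Number Theory* (1999), Ch. VI §5 Prop. (5.6), §7 Thm. (7.1).
-/

noncomputable section

open NumberField IsDedekindDomain IsDedekindDomain.HeightOneSpectrum Field
open scoped nonZeroDivisors Classical

namespace Literature.NumberTheory.NumberFields

open Literature.NumberTheory.GaloisRepresentations
open Literature.NumberTheory.GaloisRepresentations.IsNonarchimedeanLocalField
open Literature.NumberTheory.LFunctions.AbelianDensity (artinSymbol)
open ValuativeRel

variable {K : Type} [Field K] [NumberField K] {𝔪 : Ideal (𝓞 K)} {v : HeightOneSpectrum (𝓞 K)}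

/-! ### §0. Restrictions (bookkeeping) -/

omit [NumberField K] in
/-- `((τ|_L) x : K̄) = τ • x`. [folklore] -/
private theorem coe_absRestrictNormalHom_apply₁₇ (L : IntermediateField K (AlgebraicClosure K)) [Normal K L]
    (τ : absoluteGaloisGroup K) (x : L) :
    ((absRestrictNormalHom L τ x : L) : AlgebraicClosure K) = τ • (x : AlgebraicClosure K) :=
  AlgEquiv.restrictNormalHom_apply L _ x

omit [NumberField K] in
/-- `res_L ρ = res_L ρ'` iff `ρ`, `ρ'` agree on `L` pointwise. [folklore] -/
private theorem absRestrictNormalHom_eq_iff_forall_smul_eq₁₇ (L : IntermediateField K (AlgebraicClosure K)) [Normal K L]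
    (ρ ρ' : absoluteGaloisGroup K) :
    absRestrictNormalHom L ρ = absRestrictNormalHom L ρ' ↔ ∀ x ∈ L, ρ • x = ρ' • x := by
  constructor
  · intro h x hx
    have e := congrArg (fun σ : L ≃ₐ[K] L ↦ ((σ ⟨x, hx⟩ : L) : AlgebraicClosure K)) h
    simpa only [coe_absRestrictNormalHom_apply₁₇] using e
  · intro h
    ext x
    rw [coe_absRestrictNormalHom_apply₁₇, coe_absRestrictNormalHom_apply₁₇]
    exact h x x.2

omit [NumberField K] in
/-- `(α)` as a unit of fractional ideals: `toPrincipalIdeal (α) = mk0 ↑(span {α})`. [folklore] -/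
private theorem toPrincipalIdeal_mk0_eq_unitsMk0_coeIdeal_span₁₇ [IsDedekindDomain (𝓞 K)] [IsFractionRing (𝓞 K) K]
    {α : 𝓞 K} (hα0 : α ≠ 0) (hαK : (α : K) ≠ 0) :
    toPrincipalIdeal (𝓞 K) K (Units.mk0 (α : K) hαK) =
      Units.mk0 ((Ideal.span {α} : Ideal (𝓞 K)) : FractionalIdeal (𝓞 K)⁰ K)
        (FractionalIdeal.coeIdeal_ne_zero.mpr (by rwa [Ne, Ideal.span_singleton_eq_bot])) := by
  ext1
  rw [coe_toPrincipalIdeal, Units.val_mk0, Units.val_mk0, FractionalIdeal.coeIdeal_span_singleton]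

variable [IsTotallyComplex K]
  (h𝔪 : 𝔪 ≠ ⊥) (hv : ¬ 𝔪 ≤ v.asIdeal) (hw : ∀ u : (𝓞 K)ˣ, (u : 𝓞 K) - 1 ∈ 𝔪 → u = 1)
  {π : 𝒪[v.adicCompletion K]} (hπ : (valuation (v.adicCompletion K)).IsUniformizer (π : v.adicCompletion K))
  {α : 𝓞 K} (hα0 : α ≠ 0) (hα𝔪 : α - 1 ∈ 𝔪) (hαw : ∀ w : HeightOneSpectrum (𝓞 K), w ≠ v → α ∉ w.asIdeal)
  {f : ℕ} (hαπ : ((α : K) : v.adicCompletion K) = (π : v.adicCompletion K) ^ f)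
  (E : IntermediateField (v.adicCompletion K) (AlgebraicClosure (v.adicCompletion K)))
  [FiniteDimensional (v.adicCompletion K) E]
  (hdegE : ∀ w : WeilGroup (v.adicCompletion K),
    WeilGroup.toAbsGalois (v.adicCompletion K) w ∈ E.fixingSubgroup → (f : ℤ) ∣ WeilGroup.deg w)
  (hinertE : ∀ τ : absoluteGaloisGroup (v.adicCompletion K),
    (∀ y ∈ rayClassField K 𝔪, τ • absClosureEmbedding K (v.adicCompletion K) y = absClosureEmbedding K (v.adicCompletion K) y) →
      τ ∈ E.fixingSubgroup)

/-! ### §1. `χ_π(σ̃)` is determined by the restrictions of `σ̃` to the `v`-tower `K(𝔪v^{k+1})` -/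

include h𝔪 hv hw hα0 hα𝔪 hαw hαπ hdegE hinertE in
/-- ★ **The Lubin–Tate character of a local element is determined by its restrictions to the global `v`-tower**: if
`σ̃, σ̃' ∈ Γ_{K_v}` have the same restriction to every `K(𝔪v^{k+1})` (along `ι`), then `χ_π(σ̃) = χ_π(σ̃')` — the quotient
`σ̃⁻¹σ̃'` fixes `ι K(𝔪)` (so `E`, INERT) and every `ι K(𝔪v^{k+1})`, hence every `K_π^{k+1}` (the local tower is generated by the
global one over `E`), where `χ_π = 1`. [cite: deShalit1987, II.1.10 Lemma (p. 39), II.4.12 (p. 66)]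
[cite: CasselsFrohlichANT1967, Ch. VI §3.6 Prop. 6] -/
theorem lubinTateChar_eq_of_forall_absRestrictNormalHom_eq {σ σ' : absoluteGaloisGroup (v.adicCompletion K)}
    (h : ∀ k : ℕ, absRestrictNormalHom (rayClassField K (𝔪 * v.asIdeal ^ (k + 1))) (absGaloisRestrict K (v.adicCompletion K) σ) =
      absRestrictNormalHom (rayClassField K (𝔪 * v.asIdeal ^ (k + 1))) (absGaloisRestrict K (v.adicCompletion K) σ')) :
    lubinTateChar hπ σ = lubinTateChar hπ σ' := by
  have key : lubinTateChar hπ (σ⁻¹ * σ') = 1 := by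
    rw [lubinTateChar_eq_one_iff]
    intro n x hx
    -- `σ⁻¹σ'` fixes `ι K(𝔪v^{n+1})` pointwise
    have hfixι : ∀ y ∈ rayClassField K (𝔪 * v.asIdeal ^ (n + 1)),
        (σ⁻¹ * σ') • absClosureEmbedding K (v.adicCompletion K) y = absClosureEmbedding K (v.adicCompletion K) y := by
      intro y hy
      have e := (absRestrictNormalHom_eq_iff_forall_smul_eq₁₇ _ _ _).mp (h n) y hy
      rw [← absGaloisRestrict_apply_smul, map_mul, map_inv, mul_smul, ← e, inv_smul_smul]
    -- hence fixes `E` (INERT, `K(𝔪) ≤ K(𝔪v^{n+1})`) and `K_π^{n+1}`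
    have hle : rayClassField K 𝔪 ≤ rayClassField K (𝔪 * v.asIdeal ^ (n + 1)) :=
      rayClassField_le_of_le (mul_ne_zero h𝔪 (pow_ne_zero _ v.ne_bot)) Ideal.mul_le_right
    have hE : σ⁻¹ * σ' ∈ E.fixingSubgroup := hinertE _ fun y hy ↦ hfixι y (hle hy)
    have hlt := mem_fixingSubgroup_ltField_of_forall_smul_absClosureEmbedding_eq h𝔪 hv hw hπ hα0 hα𝔪 hαw hαπ E hdegE n hE hfixι
    have e := (IntermediateField.mem_fixingSubgroup_iff _ _).mp hlt x hx
    exact e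
  calc lubinTateChar hπ σ = lubinTateChar hπ σ * lubinTateChar hπ (σ⁻¹ * σ') := by rw [key, mul_one]
    _ = lubinTateChar hπ σ' := by rw [← lubinTateChar_mul, mul_inv_cancel_left]

/-! ### §2. `χ_π(σ̃_{(a)}) = a` for principal `(a)`, `a ≡ 1 mod 𝔪`, `v ∤ a` -/

include h𝔪 hv hw hα0 hα𝔪 hαw hαπ hdegE hinertE in
/-- ★★ **`χ_π(σ̃) = a` for every local lift `σ̃` of the Artin symbols `((a), K(𝔪v^{k+1})/K)`** (`a ∈ 𝓞_K`, `a ≠ 0`,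
`a ≡ 1 mod 𝔪`, `v ∤ a`; symbols as `artinHom` of the fractional ideal `(a)`): the inertia element `w` with `Art(w) = a_v` has the
same restrictions (`[⟨a_v⁻¹⟩_v, K]|_{K(𝔪v^{k+1})} = ((a), ·)`), so `χ_π(σ̃) = χ_π(w) = Art(w) = a_v` (§1 and Lubin–Tate reciprocity
`χ_π = Art` on inertia) — de Shalit's `κ(σ_{(α)}) = α` read on the `𝔭`-division tower.
[cite: deShalit1987, II.1.7 (p. 41), II.4.12 (p. 66–68)] [cite: CasselsFrohlichANT1967, Ch. VI §3.7 Thm. 3]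
[cite: NeukirchANT1999, Ch. VI §5 Prop. (5.6), §7 Thm. (7.1)] -/
theorem coe_lubinTateChar_eq_of_forall_eq_artinHom {a : 𝓞 K} (ha0 : a ≠ 0) (ha𝔪 : a - 1 ∈ 𝔪) (hav : a ∉ v.asIdeal)
    {σ : absoluteGaloisGroup (v.adicCompletion K)}
    (hσ : ∀ k : ℕ, absRestrictNormalHom (rayClassField K (𝔪 * v.asIdeal ^ (k + 1))) (absGaloisRestrict K (v.adicCompletion K) σ) =
      artinHom (galFrob K (rayClassField K (𝔪 * v.asIdeal ^ (k + 1))))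
        (toPrincipalIdeal (𝓞 K) K (Units.mk0 (a : K) (by exact_mod_cast ha0)))) :
    (((lubinTateChar hπ σ : 𝒪[v.adicCompletion K]ˣ) : 𝒪[v.adicCompletion K]) : v.adicCompletion K) =
      ((a : K) : v.adicCompletion K) := by
  have ha := isLocalArtinMap_canonicalArtin_holds (v.adicCompletion K)
  -- the inertia element with `Art(w) = a_v`
  obtain ⟨w, hwI, hwu⟩ := exists_mem_inertia_artin_eq ha (integerUnit v a hav)
  have hres : ∀ k : ℕ, absRestrictNormalHom (rayClassField K (𝔪 * v.asIdeal ^ (k + 1))) (absGaloisRestrict K (v.adicCompletion K) σ) =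
      absRestrictNormalHom (rayClassField K (𝔪 * v.asIdeal ^ (k + 1)))
        (absGaloisRestrict K (v.adicCompletion K) (WeilGroup.toAbsGalois (v.adicCompletion K) w)) := fun k ↦ by
    rw [hσ k, isAdicArtinValue_inv_of_mem_inertia ha w hwu.symm (k + 1),
      abRestrict_ideleArtinMap_localUnits_integerUnit_inv h𝔪 hv ha0 ha𝔪 hav (k + 1)]
  rw [lubinTateChar_eq_of_forall_absRestrictNormalHom_eq h𝔪 hv hw hπ hα0 hα𝔪 hαw hαπ E hdegE hinertE hres,
    coe_lubinTateChar_toAbsGalois_canonicalArtin hπ hwI, hwu]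
  rfl

include h𝔪 hv hw hα0 hα𝔪 hαw hαπ hdegE hinertE in
/-- ★★ **`χ_π(σ̃) = a`, Artin symbols as `artinSymbol (span {a})`** (the form of the elliptic-unit product rule).
[cite: deShalit1987, II.1.7 (p. 41), II.4.12 (p. 66–68)] [cite: NeukirchANT1999, Ch. VI §7 Thm. (7.1)] -/
theorem coe_lubinTateChar_eq_of_forall_eq_artinSymbol_span_singleton {a : 𝓞 K} (ha0 : a ≠ 0) (ha𝔪 : a - 1 ∈ 𝔪)
    (hav : a ∉ v.asIdeal) {σ : absoluteGaloisGroup (v.adicCompletion K)}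
    (hσ : ∀ k : ℕ, absRestrictNormalHom (rayClassField K (𝔪 * v.asIdeal ^ (k + 1))) (absGaloisRestrict K (v.adicCompletion K) σ) =
      artinSymbol (galFrob K (rayClassField K (𝔪 * v.asIdeal ^ (k + 1)))) (Ideal.span {a})) :
    (((lubinTateChar hπ σ : 𝒪[v.adicCompletion K]ˣ) : 𝒪[v.adicCompletion K]) : v.adicCompletion K) =
      ((a : K) : v.adicCompletion K) := by
  refine coe_lubinTateChar_eq_of_forall_eq_artinHom h𝔪 hv hw hπ hα0 hα𝔪 hαw hαπ E hdegE hinertE ha0 ha𝔪 hav fun k ↦ ?_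
  rw [hσ k, toPrincipalIdeal_mk0_eq_unitsMk0_coeIdeal_span₁₇ ha0, artinHom_unitsMk0_coeIdeal _
    (by rwa [Ne, Ideal.span_singleton_eq_bot])]

/-! ### §3. The bottom row of the two-variable tower: `χ_π(σ̃_{𝔞₁}) = α₁` for `𝔞₁ = (α₁)`, `α₁ ≡ 1 mod 𝔤v'` -/

omit h𝔪 hv hw hα0 hα𝔪 hαw hαπ E hdegE hinertE in
/-- ★★ **`χ_π(σ̃_{(a)}) = a` on the two-variable tower of `RayClassFieldTwoVariableDecomposition`** (auxiliary prime `v' ≠ v`,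
`v ∤ 𝔤`, `w_{𝔤v'} = 1`, absolute model `α_0 = π^{f_0} ≡ 1 mod 𝔤v'`, base `E_c` with `f_0 ∣ deg` on `Γ_{E_c}` and INERT at level
`0`): for `a ≡ 1 mod 𝔤v'`, `v ∤ a`, every local lift `σ̃` of the Artin symbols of `(a)` on the bottom row `K(𝔤v'v^{k+1})`
(`i = 0` of the capstone's `hσ`) has **`χ_π(σ̃) = a` in `K_v`** — so hypothesis (A) `χ_π(σ̃_{a₁}) = γ = 1 + π²w` of the
(c)-capstone is met by the liftable principal index `𝔞₁ = (α₁)` for any `α₁ ≡ 1 mod 𝔤v'` with `v(α₁ − 1) = 2`.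
[cite: deShalit1987, II.4.12 (p. 66–68), II.4.17 (p. 78)] [cite: NeukirchANT1999, Ch. VI §7 Thm. (7.1)] -/
theorem coe_lubinTateChar_eq_of_forall_eq_artinSymbol_span_singleton₂ {𝔤 : Ideal (𝓞 K)} {v' : HeightOneSpectrum (𝓞 K)}
    (h𝔤0 : 𝔤 ≠ ⊥) (hv : ¬ 𝔤 ≤ v.asIdeal) (hvv' : v' ≠ v) (hw : ∀ u : (𝓞 K)ˣ, (u : 𝓞 K) - 1 ∈ 𝔤 * v'.asIdeal → u = 1)
    {α : ℕ → 𝓞 K} (hα0 : ∀ i, α i ≠ 0) (hα𝔪 : ∀ i, α i - 1 ∈ 𝔤 * v'.asIdeal ^ (i + 1))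
    (hαw : ∀ i, ∀ w : HeightOneSpectrum (𝓞 K), w ≠ v → α i ∉ w.asIdeal)
    {f : ℕ → ℕ} (hαπ : ∀ i, ((α i : K) : v.adicCompletion K) = (π : v.adicCompletion K) ^ f i)
    (E : ℕ → IntermediateField (v.adicCompletion K) (AlgebraicClosure (v.adicCompletion K)))
    [∀ j, FiniteDimensional (v.adicCompletion K) (E j)] (c : ℕ)
    (hdegE : ∀ i, ∀ w : WeilGroup (v.adicCompletion K),
      WeilGroup.toAbsGalois (v.adicCompletion K) w ∈ (E (i + c)).fixingSubgroup → (f i : ℤ) ∣ WeilGroup.deg w)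
    (hinert : ∀ i, ∀ τ : absoluteGaloisGroup (v.adicCompletion K),
      (∀ y ∈ rayClassField K (𝔤 * v'.asIdeal ^ (i + 1)),
        τ • absClosureEmbedding K (v.adicCompletion K) y = absClosureEmbedding K (v.adicCompletion K) y) →
        τ ∈ (E (i + c)).fixingSubgroup)
    {a : 𝓞 K} (ha0 : a ≠ 0) (ha𝔪 : a - 1 ∈ 𝔤 * v'.asIdeal) (hav : a ∉ v.asIdeal) {σ : absoluteGaloisGroup (v.adicCompletion K)}
    (hσ : ∀ k : ℕ, absRestrictNormalHom (rayClassField K (𝔤 * v'.asIdeal ^ ((0 : ℕ) + 1) * v.asIdeal ^ (k + 1)))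
        (absGaloisRestrict K (v.adicCompletion K) σ) =
      artinSymbol (galFrob K (rayClassField K (𝔤 * v'.asIdeal ^ ((0 : ℕ) + 1) * v.asIdeal ^ (k + 1)))) (Ideal.span {a})) :
    (((lubinTateChar hπ σ : 𝒪[v.adicCompletion K]ˣ) : 𝒪[v.adicCompletion K]) : v.adicCompletion K) =
      ((a : K) : v.adicCompletion K) := by
  have h𝔪0 : 𝔤 * v'.asIdeal ^ ((0 : ℕ) + 1) ≠ ⊥ := mul_ne_zero h𝔤0 (pow_ne_zero _ v'.ne_bot)
  have h𝔪v : ¬ 𝔤 * v'.asIdeal ^ ((0 : ℕ) + 1) ≤ v.asIdeal := by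
    intro h
    rcases (v.isPrime.mul_le).mp h with h1 | h2
    · exact hv h1
    · exact hvv' (HeightOneSpectrum.ext ((v'.isMaximal.eq_of_le v.isPrime.ne_top ((Ideal.IsPrime.pow_le_iff (hP := v.isPrime)
        (Nat.succ_ne_zero 0)).mp h2))))
  have hw0 : ∀ u : (𝓞 K)ˣ, (u : 𝓞 K) - 1 ∈ 𝔤 * v'.asIdeal ^ ((0 : ℕ) + 1) → u = 1 := fun u hu ↦ hw u (by rwa [zero_add, pow_one] at hu)
  have ha𝔪0 : a - 1 ∈ 𝔤 * v'.asIdeal ^ ((0 : ℕ) + 1) := by rwa [zero_add, pow_one]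
  exact coe_lubinTateChar_eq_of_forall_eq_artinSymbol_span_singleton h𝔪0 h𝔪v hw0 hπ (hα0 0) (hα𝔪 0) (hαw 0) (hαπ 0) (E (0 + c))
    (hdegE 0) (hinert 0) ha0 ha𝔪0 hav hσ

end Literature.NumberTheory.NumberFields

end
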